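import Summits.NavierStokesRegularity.NavierStokesRegularity.Theorems.TypeICertificateLadderTargetRotationDefectWeight
import Literature.Analysis.FluidPDE.PineauVicolWeightPositivity
import Literature.Analysis.FluidPDE.AxisymNoSwirlScalarEq
import HarnessLib

/-!
# Crux `Target` (stmt-NavierStokesRegularity-1217), line `killing-twisted-bernoulli-solitons`:
  the TORQUE IDENTITY for rotated self-similar profiles (tool for stub B5b)

Support file (theorems only, `--supports stmt-NavierStokesRegularity-1217`). The line card's
handle on the window stub B5b is the "torque form" of the soliton identity: for a conjugate
density `m = m_α` in the kernel of the adjoint of the ROTATING drift–Laplace operator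
`L_α = −Δ + (U + ½y − αJy)·∇` (stub B2), the mean axial vorticity is a PRESSURE TORQUE against
the angular derivative of the density,

  `2 ∫ (curl U)₂ m = ∫ P ∂_θ m`,   `∂_θ m = Dm(Jy)`,

so that, with the soliton identity of stub B3 (`∫ |curl U|² m = 2α ∫ (curl U)₂ m`),
`∫ |curl U|² m = α ∫ P ∂_θ m`: a window soliton needs an angularly LOPSIDED conjugate density.

* `torque_swirl_identity` — the pointwise identity behind it: for smooth `(U, P)` solving the
  RSS profile system (Pineau–Vicol (1.8a)), the swirl `Γ = ⟪Jy, U⟫` satisfies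
  `L_α Γ = −ΔΓ + DΓ[U + ½y − αJy] = −DP(Jy) − 2 (curl U)₂`
  (`ΔΓ = ⟪Jy, ΔU⟫ + 2Ω₃`, `DΓ[w] = ⟪Jy, DU w⟫ + ⟪Jw, U⟫`, the system dotted with `Jy`, and the
  skewness of `J`; every `α`-term cancels).
* `torque_pairing` — pairing with a `C²` weight `m` in the kernel of `L_α†`
  (`Δm + div(m(U + ½y − αJy)) = 0`) with Gaussian bounds on `m`, `∇m` and the Type-I bounds on
  `U, DU, ΔU`: `2 ∫ (curl U)₂ m = −∫ DP(Jy) m` (tree `integral_weight_mul_drift_eq_zero`, its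
  four integrability hypotheses discharged from the bounds file).
* `torque_ibp` — `−∫ DP(Jy) m = ∫ P Dm(Jy)` (`div((P m) J·) = DP(Jy) m + P Dm(Jy)`, `div J = 0`);
  `torque_identity` — the torque form `2 ∫ (curl U)₂ m = ∫ P Dm(Jy)`.

## References

* B. Pineau, V. Vicol, arXiv:2607.09619 (2026): (1.8a) p. 3, Lemma 4.1 (4.6) p. 12 (`∂_θ`),
  Prop. 5.1 / Remark 5.2 pp. 12–13 (kernel of the adjoint), (5.4) p. 13. [PineauVicol2026]
-/

noncomputable section

namespace Summit.NavierStokesRegularity.NavierStokesRegularity.Theorems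

open MeasureTheory Set Function Filter Topology InnerProductSpace Real Metric
open scoped RealInnerProductSpace Laplacian ContDiff BigOperators ENNReal NNReal
open Literature.Analysis.FluidPDE Literature.Analysis.FluidPDE.PineauVicol2026

/-! ### The pointwise swirl identity -/

/-- **The rotating drift–Laplace operator applied to the swirl.** Let `U`, `P` be smooth on
`ℝ³` and solve the rotated self-similar profile system (Pineau–Vicol (1.8a))
`α(JU − DU(Jy)) + ½U + ½DU(y) − ΔU + DU(U) + ∇P = 0`, `J = rotGen`. Then the swirl
`Γ(y) = swirl U y = ⟪Jy, U(y)⟫` satisfies, for every `y`,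
`−ΔΓ(y) + DΓ(y)[U(y) + ½y − αJy] = −DP(y)(Jy) − 2 (curl U(y))₂`.
(No divergence-free condition is needed; all `α`-terms cancel by `⟪JJy, U⟫ = −⟪Jy, JU⟫`.)
[cite: PineauVicol2026, (1.8a) (p. 3) and Lemma 4.1 (p. 12)] -/
theorem torque_swirl_identity {α : ℝ} {U : EuclideanSpace ℝ (Fin 3) → EuclideanSpace ℝ (Fin 3)}
    {P : EuclideanSpace ℝ (Fin 3) → ℝ} (hU : ContDiff ℝ 2 U)
    (heq : ∀ y, α • (rotGen (U y) - fderiv ℝ U y (rotGen y)) + (1 / 2 : ℝ) • U y +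
      (1 / 2 : ℝ) • fderiv ℝ U y y - (Δ U) y + fderiv ℝ U y (U y) + gradient P y = 0)
    (y : EuclideanSpace ℝ (Fin 3)) :
    -(Δ (swirl U)) y + fderiv ℝ (swirl U) y (U y + (1 / 2 : ℝ) • y - α • rotGen y) =
      -(fderiv ℝ P y (rotGen y)) - 2 * (curl U y) 2 := by
  have hUd : Differentiable ℝ U := hU.differentiable two_ne_zero
  have hDS := fderiv_swirl_apply (hUd y) (U y + (1 / 2 : ℝ) • y - α • rotGen y)
  have hΔS := laplacian_swirl hU y
  have hΩ : curl U y 2 = fderiv ℝ U y (EuclideanSpace.single 0 1) 1 -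
      fderiv ℝ U y (EuclideanSpace.single 1 1) 0 := by
    simp [curl]
  -- the system dotted with `Jy`
  have hEJ : ⟪rotGen y, α • (rotGen (U y) - fderiv ℝ U y (rotGen y)) + (1 / 2 : ℝ) • U y +
      (1 / 2 : ℝ) • fderiv ℝ U y y - Δ U y + fderiv ℝ U y (U y) + gradient P y⟫ = 0 := by
    rw [heq y, inner_zero_right]
  simp only [inner_add_right, inner_sub_right, real_inner_smul_right, inner_gradient_right,
    RCLike.conj_to_real] at hEJ
  -- skewness and linearity of `J`
  have hJU : ⟪rotGen (U y), U y⟫ = 0 := inner_rotGen_self (U y)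
  have hJJ : ⟪rotGen (rotGen y), U y⟫ + ⟪rotGen y, rotGen (U y)⟫ = 0 := by
    rw [inner_rotGen_left, inner_rotGen_left]
    simp only [rotGen_apply_zero, rotGen_apply_one]
    ring
  have hJb : rotGen (U y + (1 / 2 : ℝ) • y - α • rotGen y) =
      rotGen (U y) + (1 / 2 : ℝ) • rotGen y - α • rotGen (rotGen y) := by
    rw [← rotGenL_apply, map_sub, map_add, map_smul, map_smul]
    rfl
  rw [hDS, hJb, hΔS, hΩ]
  simp only [map_add, map_sub, map_smul, inner_add_right, inner_sub_right,
    real_inner_smul_right, inner_add_left, inner_sub_left, real_inner_smul_left]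
  linear_combination hEJ + hJU - α * hJJ

/-! ### Pairing with a conjugate density of the rotating operator -/

/-- **Pairing the swirl identity with a weight in the kernel of the rotating adjoint.** Let
`U, P` be smooth and solve the RSS profile system with `|U| ≤ C₀`, `‖DU‖ ≤ C₁`, `‖ΔU‖ ≤ C₂`,
and let `m ∈ C²` be positive with `Δm + div(m (U + ½y − αJy)) = 0` (the stationary
Fokker–Planck equation of the ROTATING-frame diffusion, stub B2), `m ≤ M₁ e^{−|y|²/16}` and
`‖Dm‖ ≤ M₂ e^{−|y|²/32}`. Then `2 ∫ (curl U)₂ m = −∫ DP(Jy) m`: the whole-space pairing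
`∫ m L_αΓ = 0` (tree `integral_weight_mul_drift_eq_zero`, its integrability hypotheses from the
polynomial growth of `Γ = ⟪Jy, U⟫`, `∇Γ`, `DP(Jy)` against the Gaussian bounds) applied to
`torque_swirl_identity`. [cite: PineauVicol2026, (5.4) (p. 13), Remark 5.2 (p. 13)] -/
theorem torque_pairing {α C₀ C₁ C₂ M₁ M₂ : ℝ}
    {U : EuclideanSpace ℝ (Fin 3) → EuclideanSpace ℝ (Fin 3)} {P m : EuclideanSpace ℝ (Fin 3) → ℝ}
    (hU : ContDiff ℝ ∞ U) (hP : ContDiff ℝ ∞ P)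
    (heq : ∀ y, α • (rotGen (U y) - fderiv ℝ U y (rotGen y)) + (1 / 2 : ℝ) • U y +
      (1 / 2 : ℝ) • fderiv ℝ U y y - (Δ U) y + fderiv ℝ U y (U y) + gradient P y = 0)
    (hC₀ : 0 ≤ C₀) (hUb : ∀ y, ‖U y‖ ≤ C₀) (hC₁ : ∀ y, ‖fderiv ℝ U y‖ ≤ C₁)
    (hC₂ : ∀ y, ‖(Δ U) y‖ ≤ C₂)
    (hm : ContDiff ℝ 2 m) (hmpos : ∀ y, 0 < m y)
    (hker : ∀ y, (Δ m) y + VectorCalculus.divergence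
      (fun z => m z • (U z + (1 / 2 : ℝ) • z - α • rotGen z)) y = 0)
    (hmup : ∀ y, m y ≤ M₁ * Real.exp (-(1 / 16 : ℝ) * ‖y‖ ^ 2))
    (hgradm : ∀ y, ‖fderiv ℝ m y‖ ≤ M₂ * Real.exp (-(1 / 32 : ℝ) * ‖y‖ ^ 2)) :
    2 * ∫ y, (curl U y) 2 * m y = -∫ y, fderiv ℝ P y (rotGen y) * m y := by
  have hU2 : ContDiff ℝ 2 U := hU.of_le (by norm_cast)
  have hUd : Differentiable ℝ U := hU.differentiable (by simp)
  have hPd : Differentiable ℝ P := hP.differentiable (by simp)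
  have hC₁0 : 0 ≤ C₁ := (norm_nonneg _).trans (hC₁ 0)
  have hm0 : ∀ y, 0 ≤ m y := fun y => (hmpos y).le
  -- the players and their continuity
  set b : EuclideanSpace ℝ (Fin 3) → EuclideanSpace ℝ (Fin 3) :=
    fun y => U y + (1 / 2 : ℝ) • y - α • rotGen y with hb
  have hJc : Continuous (rotGen : EuclideanSpace ℝ (Fin 3) → EuclideanSpace ℝ (Fin 3)) :=
    rotGenL.continuous.congr fun v => rfl
  have hJs : ContDiff ℝ ∞ (rotGen : EuclideanSpace ℝ (Fin 3) → EuclideanSpace ℝ (Fin 3)) :=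
    contDiff_rotGen
  have hbs : ContDiff ℝ 1 b :=
    ((hU.of_le (by norm_cast)).add (contDiff_id.const_smul _)).sub (hJs.of_le (by norm_cast) |>.const_smul α)
  have hbc : Continuous b := hbs.continuous
  have hSs : ContDiff ℝ ∞ (swirl U) := contDiff_swirl hU
  have hS2 : ContDiff ℝ 2 (swirl U) := hSs.of_le (by norm_cast)
  have hSc : Continuous (swirl U) := hSs.continuous
  have hUc : Continuous U := hU.continuous
  have hDUc : Continuous fun y => fderiv ℝ U y := hU.continuous_fderiv (by simp)
  have hDPc : Continuous fun y => fderiv ℝ P y := hP.continuous_fderiv (by simp)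
  have hmc : Continuous m := hm.continuous
  have hDmc : Continuous fun y => fderiv ℝ m y := hm.continuous_fderiv (by norm_num)
  have hsymmc : Continuous fun L : EuclideanSpace ℝ (Fin 3) →L[ℝ] ℝ =>
      (InnerProductSpace.toDual ℝ (EuclideanSpace ℝ (Fin 3))).symm L :=
    (InnerProductSpace.toDual ℝ (EuclideanSpace ℝ (Fin 3))).symm.continuous
  have hgradSc : Continuous (gradient (swirl U)) := hsymmc.comp (hSs.continuous_fderiv (by simp))
  have hgradmc : Continuous (gradient m) := hsymmc.comp hDmc
  have hcurlc : Continuous (curl U) := by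
    rw [curl_eq_curlCLM_comp]; exact curlCLM.continuous.comp hDUc
  -- pointwise bounds
  have hSb : ∀ y, |swirl U y| ≤ C₀ * (1 + ‖y‖) := fun y => by
    rw [swirl_eq_inner_rotGen]
    calc |⟪rotGen y, U y⟫| ≤ ‖rotGen y‖ * ‖U y‖ := abs_real_inner_le_norm _ _
      _ ≤ ‖y‖ * C₀ := mul_le_mul (norm_rotGen_le y) (hUb y) (norm_nonneg _) (norm_nonneg _)
      _ ≤ C₀ * (1 + ‖y‖) := by nlinarith [norm_nonneg y]
  have hgradSb : ∀ y, ‖gradient (swirl U) y‖ ≤ (C₁ + C₀) * (1 + ‖y‖) := fun y => by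
    have e : ‖gradient (swirl U) y‖ = ‖fderiv ℝ (swirl U) y‖ := by simp [gradient]
    rw [e]
    refine ContinuousLinearMap.opNorm_le_bound _ (by positivity) fun h => ?_
    rw [fderiv_swirl_apply (hUd y) h, Real.norm_eq_abs]
    have e1 : |⟪rotGen y, fderiv ℝ U y h⟫| ≤ ‖y‖ * (C₁ * ‖h‖) :=
      (abs_real_inner_le_norm _ _).trans (mul_le_mul (norm_rotGen_le y)
        ((ContinuousLinearMap.le_opNorm _ _).trans (mul_le_mul_of_nonneg_right (hC₁ y) (norm_nonneg h)))
        (norm_nonneg _) (norm_nonneg _))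
    have e2 : |⟪rotGen h, U y⟫| ≤ ‖h‖ * C₀ :=
      (abs_real_inner_le_norm _ _).trans (mul_le_mul (norm_rotGen_le h) (hUb y) (norm_nonneg _) (norm_nonneg _))
    have hh := norm_nonneg h
    have hyy := norm_nonneg y
    calc |⟪rotGen y, fderiv ℝ U y h⟫ + ⟪rotGen h, U y⟫| ≤ ‖y‖ * (C₁ * ‖h‖) + ‖h‖ * C₀ :=
          (abs_add_le _ _).trans (add_le_add e1 e2)
      _ ≤ (C₁ + C₀) * (1 + ‖y‖) * ‖h‖ := by nlinarith [mul_nonneg hC₁0 hh, mul_nonneg hC₀ hh]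
  set Cp : ℝ := |α| * (C₀ + C₁) + C₀ + C₁ + C₂ + C₁ * C₀ with hCp
  have hCp0 : 0 ≤ Cp := by
    have hC₂0 : 0 ≤ C₂ := (norm_nonneg _).trans (hC₂ 0)
    positivity
  have hDPb : ∀ y, ‖fderiv ℝ P y‖ ≤ Cp * (1 + ‖y‖) := fun y => by
    have h := rotationDefect_norm_gradient_pressure_le hC₀ hUb hC₁ hC₂ heq y
    have e : ‖gradient P y‖ = ‖fderiv ℝ P y‖ := by simp [gradient]
    rwa [e] at h
  have hDPJb : ∀ y, |fderiv ℝ P y (rotGen y)| ≤ Cp * (1 + ‖y‖) ^ 2 := fun y => by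
    rw [← Real.norm_eq_abs]
    calc ‖fderiv ℝ P y (rotGen y)‖ ≤ ‖fderiv ℝ P y‖ * ‖rotGen y‖ := ContinuousLinearMap.le_opNorm _ _
      _ ≤ Cp * (1 + ‖y‖) * ‖y‖ := mul_le_mul (hDPb y) (norm_rotGen_le y) (norm_nonneg _) (by positivity)
      _ ≤ Cp * (1 + ‖y‖) ^ 2 := by
          rw [sq, ← mul_assoc]
          exact mul_le_mul_of_nonneg_left (by linarith [norm_nonneg y]) (by positivity)
  have hcurl2b : ∀ y, |(curl U y) 2| ≤ ‖curlCLM‖ * C₁ := fun y => by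
    have h1 : |(curl U y) 2| ≤ ‖curl U y‖ := by
      have h := PiLp.norm_apply_le (curl U y) 2
      rwa [Real.norm_eq_abs] at h
    exact h1.trans ((norm_curl_le U y).trans (mul_le_mul_of_nonneg_left (hC₁ y) (norm_nonneg curlCLM)))
  have hbb : ∀ y, ‖b y‖ ≤ (C₀ + 1 + |α|) * (1 + ‖y‖) := fun y => by
    simp only [hb]
    calc ‖U y + (1 / 2 : ℝ) • y - α • rotGen y‖ ≤ ‖U y + (1 / 2 : ℝ) • y‖ + ‖α • rotGen y‖ := norm_sub_le _ _
      _ ≤ (C₀ + 1) * (1 + ‖y‖) + |α| * ‖y‖ := add_le_add (rotationDefect_norm_drift_le hC₀ hUb y)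
          (by rw [norm_smul, Real.norm_eq_abs]; exact mul_le_mul_of_nonneg_left (norm_rotGen_le y) (abs_nonneg _))
      _ ≤ (C₀ + 1 + |α|) * (1 + ‖y‖) := by nlinarith [abs_nonneg α, norm_nonneg y]
  -- the pointwise identity
  have hpt : ∀ y, -(Δ (swirl U)) y + fderiv ℝ (swirl U) y (b y) =
      -(fderiv ℝ P y (rotGen y)) - 2 * (curl U y) 2 := fun y =>
    torque_swirl_identity hU2 heq y
  -- integrability hypotheses of the pairing lemma
  have hint : Integrable fun y => m y * (-(Δ (swirl U)) y + fderiv ℝ (swirl U) y (b y)) := by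
    have h := rotationDefect_integrable_weight_mul
      (g := fun y => -(fderiv ℝ P y (rotGen y)) - 2 * (curl U y) 2) hmc
      (((hDPc.clm_apply hJc).neg).sub (continuous_const.mul
        ((continuous_apply 2).comp ((PiLp.continuous_ofLp 2 _).comp hcurlc)))) hm0 hmup
      (C := Cp + 2 * (‖curlCLM‖ * C₁)) (N := 2) fun y => by
        have hsq : (1 : ℝ) ≤ (1 + ‖y‖) ^ 2 := rotationDefect_one_le_pow y 2
        calc |-(fderiv ℝ P y (rotGen y)) - 2 * (curl U y) 2|
            ≤ |fderiv ℝ P y (rotGen y)| + 2 * |(curl U y) 2| := by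
              refine (abs_sub _ _).trans (add_le_add (by rw [abs_neg]) ?_)
              rw [abs_mul, abs_of_nonneg (by norm_num : (0:ℝ) ≤ 2)]
          _ ≤ Cp * (1 + ‖y‖) ^ 2 + 2 * (‖curlCLM‖ * C₁) := add_le_add (hDPJb y)
              (mul_le_mul_of_nonneg_left (hcurl2b y) (by norm_num))
          _ ≤ (Cp + 2 * (‖curlCLM‖ * C₁)) * (1 + ‖y‖) ^ 2 := by
              have : 0 ≤ 2 * (‖curlCLM‖ * C₁) := by positivity
              nlinarith
    exact h.congr (Eventually.of_forall fun y => by simp only [hpt y])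
  have h₁ : Integrable fun y => |m y| * ‖gradient (swirl U) y‖ := by
    have h := rotationDefect_integrable_weight_mul (g := fun y => ‖gradient (swirl U) y‖) hmc
      (continuous_norm.comp hgradSc) hm0 hmup (C := C₁ + C₀) (N := 1) fun y => by
        rw [abs_of_nonneg (norm_nonneg _), pow_one]; exact hgradSb y
    exact h.congr (Eventually.of_forall fun y => by simp only [abs_of_nonneg (hm0 y)])
  have h₂ : Integrable fun y => |swirl U y| * ‖gradient m y‖ := by
    refine rotationDefect_integrable_of_le_poly_gauss
      ((continuous_abs.comp hSc).mul (continuous_norm.comp hgradmc)).aestronglyMeasurable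
      (C := C₀ * M₂) (c := 1 / 32) (N := 1) (by norm_num) fun y => ?_
    rw [Real.norm_eq_abs, abs_mul, abs_abs, abs_of_nonneg (norm_nonneg _), pow_one]
    have e : ‖gradient m y‖ = ‖fderiv ℝ m y‖ := by simp [gradient]
    rw [e]
    calc |swirl U y| * ‖fderiv ℝ m y‖ ≤ C₀ * (1 + ‖y‖) * (M₂ * Real.exp (-(1 / 32 : ℝ) * ‖y‖ ^ 2)) :=
          mul_le_mul (hSb y) (hgradm y) (norm_nonneg _) (by positivity)
      _ = C₀ * M₂ * ((1 + ‖y‖) * Real.exp (-(1 / 32 : ℝ) * ‖y‖ ^ 2)) := by ring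
  have h₃ : Integrable fun y => |swirl U y| * |m y| * ‖b y‖ := by
    have h := rotationDefect_integrable_weight_mul (g := fun y => |swirl U y| * ‖b y‖) hmc
      ((continuous_abs.comp hSc).mul (continuous_norm.comp hbc)) hm0 hmup
      (C := C₀ * (C₀ + 1 + |α|)) (N := 2) fun y => by
        rw [abs_mul, abs_abs, abs_of_nonneg (norm_nonneg _)]
        calc |swirl U y| * ‖b y‖ ≤ C₀ * (1 + ‖y‖) * ((C₀ + 1 + |α|) * (1 + ‖y‖)) :=
              mul_le_mul (hSb y) (hbb y) (norm_nonneg _) (by positivity)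
          _ = C₀ * (C₀ + 1 + |α|) * (1 + ‖y‖) ^ 2 := by ring
    refine h.congr (Eventually.of_forall fun y => ?_)
    simp only [abs_of_nonneg (hm0 y)]; ring
  -- the pairing
  have h0 := integral_weight_mul_drift_eq_zero hS2 hm hbs hker hint h₁ h₂ h₃
  -- split the integral
  have iP : Integrable fun y => fderiv ℝ P y (rotGen y) * m y := by
    have h := rotationDefect_integrable_weight_mul (g := fun y => fderiv ℝ P y (rotGen y)) hmc
      (hDPc.clm_apply hJc) hm0 hmup (N := 2) hDPJb
    exact h.congr (Eventually.of_forall fun y => by simp only; ring)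
  have iΩ : Integrable fun y => (curl U y) 2 * m y := by
    have h := rotationDefect_integrable_weight_mul (g := fun y => (curl U y) 2) hmc
      ((continuous_apply 2).comp ((PiLp.continuous_ofLp 2 _).comp hcurlc)) hm0 hmup
      (C := ‖curlCLM‖ * C₁) (N := 0) fun y => by rw [pow_zero, mul_one]; exact hcurl2b y
    exact h.congr (Eventually.of_forall fun y => by simp only; ring)
  have e : (fun y => m y * (-(Δ (swirl U)) y + fderiv ℝ (swirl U) y (b y))) =
      fun y => -(fderiv ℝ P y (rotGen y) * m y) - 2 * ((curl U y) 2 * m y) := by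
    funext y; rw [hpt y]; ring
  have iPn : Integrable fun y => -(fderiv ℝ P y (rotGen y) * m y) := iP.neg
  have iΩ2 : Integrable fun y => 2 * ((curl U y) 2 * m y) := iΩ.const_mul 2
  rw [e, integral_sub iPn iΩ2, integral_neg, integral_const_mul] at h0
  linarith

/-! ### Moving the angular derivative onto the density -/

/-- **`−∫ DP(Jy) m = ∫ P Dm(Jy)`** for a polynomially bounded smooth `P` and a positive `C²`
density with Gaussian bounds on `m`, `Dm`: `div((P m) J·) = DP(Jy) m + P Dm(Jy)` (`div J = 0`)
and `∫ div = 0` for an integrable `C¹` field with integrable divergence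
(`PineauVicol2026.integral_divergence_eq_zero_of_integrable`). [folklore] -/
theorem torque_ibp {M₁ M₂ A : ℝ} {P m : EuclideanSpace ℝ (Fin 3) → ℝ}
    (hP : ContDiff ℝ ∞ P) (hPb : ∀ y, |P y| ≤ A * (1 + ‖y‖) ^ 2)
    {Cp : ℝ} (hDPb : ∀ y, ‖fderiv ℝ P y‖ ≤ Cp * (1 + ‖y‖))
    (hm : ContDiff ℝ 2 m) (hmpos : ∀ y, 0 < m y)
    (hmup : ∀ y, m y ≤ M₁ * Real.exp (-(1 / 16 : ℝ) * ‖y‖ ^ 2))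
    (hgradm : ∀ y, ‖fderiv ℝ m y‖ ≤ M₂ * Real.exp (-(1 / 32 : ℝ) * ‖y‖ ^ 2)) :
    -∫ y, fderiv ℝ P y (rotGen y) * m y = ∫ y, P y * fderiv ℝ m y (rotGen y) := by
  have hPd : Differentiable ℝ P := hP.differentiable (by simp)
  have hmd : Differentiable ℝ m := hm.differentiable two_ne_zero
  have hm0 : ∀ y, 0 ≤ m y := fun y => (hmpos y).le
  have hPc : Continuous P := hP.continuous
  have hmc : Continuous m := hm.continuous
  have hDPc : Continuous fun y => fderiv ℝ P y := hP.continuous_fderiv (by simp)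
  have hDmc : Continuous fun y => fderiv ℝ m y := hm.continuous_fderiv (by norm_num)
  have hJc : Continuous (rotGen : EuclideanSpace ℝ (Fin 3) → EuclideanSpace ℝ (Fin 3)) :=
    rotGenL.continuous.congr fun v => rfl
  have hJs : ContDiff ℝ ∞ (rotGen : EuclideanSpace ℝ (Fin 3) → EuclideanSpace ℝ (Fin 3)) :=
    contDiff_rotGen
  have hCp0 : 0 ≤ Cp := by
    have := (norm_nonneg _).trans (hDPb 0); simpa using this
  -- the field `F = (P m) • J·` and its divergence
  set F : EuclideanSpace ℝ (Fin 3) → EuclideanSpace ℝ (Fin 3) := fun y => (P y * m y) • rotGen y with hF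
  have hPm1 : ContDiff ℝ 1 (fun y => P y * m y) := (hP.of_le (by norm_cast)).mul (hm.of_le (by norm_cast))
  have hF1 : ContDiff ℝ 1 F := hPm1.smul (hJs.of_le (by norm_cast))
  have hdivJ : ∀ x : EuclideanSpace ℝ (Fin 3), VectorCalculus.divergence rotGen x = 0 := fun x => by
    rw [divergence_eq_sum_inner_fderiv (EuclideanSpace.basisFun (Fin 3) ℝ), fderiv_rotGen]
    refine Finset.sum_eq_zero fun i _ => ?_
    rw [rotGenL_apply, real_inner_comm, inner_rotGen_self]
  have hdivF : ∀ y, VectorCalculus.divergence F y =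
      fderiv ℝ P y (rotGen y) * m y + P y * fderiv ℝ m y (rotGen y) := fun y => by
    have hPm : DifferentiableAt ℝ (fun y => P y * m y) y := (hPd y).mul (hmd y)
    simp only [hF]
    rw [divergence_smul_apply hPm (hasFDerivAt_rotGen y).differentiableAt, hdivJ, mul_zero, zero_add,
      real_inner_comm, inner_gradient_left, fderiv_fun_mul (hPd y) (hmd y)]
    simp only [FunLike.coe_add, FunLike.coe_smul, Pi.add_apply, Pi.smul_apply, smul_eq_mul]
    ring
  -- integrability of `F` and of `div F`
  have iF : Integrable F := by
    refine rotationDefect_integrable_of_le_poly_gauss (hF1.continuous.aestronglyMeasurable)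
      (C := A * M₁) (c := 1 / 16) (N := 3) (by norm_num) fun y => ?_
    simp only [hF]
    rw [norm_smul, Real.norm_eq_abs, abs_mul, abs_of_nonneg (hm0 y)]
    have hA0 : 0 ≤ A * (1 + ‖y‖) ^ 2 := (abs_nonneg _).trans (hPb y)
    calc |P y| * m y * ‖rotGen y‖ ≤ A * (1 + ‖y‖) ^ 2 * (M₁ * Real.exp (-(1 / 16 : ℝ) * ‖y‖ ^ 2)) * (1 + ‖y‖) :=
          mul_le_mul (mul_le_mul (hPb y) (hmup y) (hm0 y) hA0)
            ((norm_rotGen_le y).trans (by linarith [norm_nonneg y])) (norm_nonneg _)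
            (mul_nonneg hA0 ((hm0 y).trans (hmup y)))
      _ = A * M₁ * ((1 + ‖y‖) ^ 3 * Real.exp (-(1 / 16 : ℝ) * ‖y‖ ^ 2)) := by ring
  have i1 : Integrable fun y => fderiv ℝ P y (rotGen y) * m y := by
    have h := rotationDefect_integrable_weight_mul (g := fun y => fderiv ℝ P y (rotGen y)) hmc
      (hDPc.clm_apply hJc) hm0 hmup (C := Cp) (N := 2) fun y => by
        rw [← Real.norm_eq_abs]
        calc ‖fderiv ℝ P y (rotGen y)‖ ≤ ‖fderiv ℝ P y‖ * ‖rotGen y‖ := ContinuousLinearMap.le_opNorm _ _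
          _ ≤ Cp * (1 + ‖y‖) * ‖y‖ := mul_le_mul (hDPb y) (norm_rotGen_le y) (norm_nonneg _) (by positivity)
          _ ≤ Cp * (1 + ‖y‖) ^ 2 := by
              rw [sq, ← mul_assoc]
              exact mul_le_mul_of_nonneg_left (by linarith [norm_nonneg y]) (by positivity)
    exact h.congr (Eventually.of_forall fun y => by simp only; ring)
  have i2 : Integrable fun y => P y * fderiv ℝ m y (rotGen y) := by
    refine rotationDefect_integrable_of_le_poly_gauss
      (hPc.mul (hDmc.clm_apply hJc)).aestronglyMeasurable
      (C := A * M₂) (c := 1 / 32) (N := 3) (by norm_num) fun y => ?_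
    rw [Real.norm_eq_abs, abs_mul]
    have hA0 : 0 ≤ A * (1 + ‖y‖) ^ 2 := (abs_nonneg _).trans (hPb y)
    have hDm : |fderiv ℝ m y (rotGen y)| ≤ M₂ * Real.exp (-(1 / 32 : ℝ) * ‖y‖ ^ 2) * (1 + ‖y‖) := by
      rw [← Real.norm_eq_abs]
      calc ‖fderiv ℝ m y (rotGen y)‖ ≤ ‖fderiv ℝ m y‖ * ‖rotGen y‖ := ContinuousLinearMap.le_opNorm _ _
        _ ≤ M₂ * Real.exp (-(1 / 32 : ℝ) * ‖y‖ ^ 2) * (1 + ‖y‖) :=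
            mul_le_mul (hgradm y) ((norm_rotGen_le y).trans (by linarith [norm_nonneg y]))
              (norm_nonneg _) ((norm_nonneg _).trans (hgradm y))
    calc |P y| * |fderiv ℝ m y (rotGen y)|
        ≤ A * (1 + ‖y‖) ^ 2 * (M₂ * Real.exp (-(1 / 32 : ℝ) * ‖y‖ ^ 2) * (1 + ‖y‖)) :=
          mul_le_mul (hPb y) hDm (abs_nonneg _) hA0
      _ = A * M₂ * ((1 + ‖y‖) ^ 3 * Real.exp (-(1 / 32 : ℝ) * ‖y‖ ^ 2)) := by ring
  have idiv : Integrable fun y => VectorCalculus.divergence F y := by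
    have e : (fun y => VectorCalculus.divergence F y) =
        fun y => fderiv ℝ P y (rotGen y) * m y + P y * fderiv ℝ m y (rotGen y) := funext hdivF
    rw [e]; exact i1.add i2
  have h0 := integral_divergence_eq_zero_of_integrable hF1 iF idiv
  have e : (fun y => VectorCalculus.divergence F y) =
      fun y => fderiv ℝ P y (rotGen y) * m y + P y * fderiv ℝ m y (rotGen y) := funext hdivF
  rw [e, integral_add i1 i2] at h0
  linarith

/-! ### The torque identity -/

/-- **The torque identity.** Under the hypotheses of `torque_pairing` (smooth `(U, P)` solving
the RSS profile system with the Type-I bounds; `m` a positive `C²` density in the kernel of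
`L_α†` with Gaussian bounds on `m`, `Dm`):
`2 ∫ (curl U)₂ m = ∫ P Dm(Jy)` — the mean axial vorticity in the conjugate measure is the
pressure torque against the angular derivative `∂_θ m = Dm(Jy)` of the density. With the soliton
identity of stub B3 this reads `∫ |curl U|² m_α = α ∫ P ∂_θ m_α` (line card, torque form).
[cite: PineauVicol2026, (5.4) (p. 13), Lemma 4.1 (4.6) (p. 12)] -/
theorem torque_identity {α C₀ C₁ C₂ M₁ M₂ : ℝ}
    {U : EuclideanSpace ℝ (Fin 3) → EuclideanSpace ℝ (Fin 3)} {P m : EuclideanSpace ℝ (Fin 3) → ℝ}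
    (hU : ContDiff ℝ ∞ U) (hP : ContDiff ℝ ∞ P)
    (heq : ∀ y, α • (rotGen (U y) - fderiv ℝ U y (rotGen y)) + (1 / 2 : ℝ) • U y +
      (1 / 2 : ℝ) • fderiv ℝ U y y - (Δ U) y + fderiv ℝ U y (U y) + gradient P y = 0)
    (hC₀ : 0 ≤ C₀) (hUb : ∀ y, ‖U y‖ ≤ C₀) (hC₁ : ∀ y, ‖fderiv ℝ U y‖ ≤ C₁)
    (hC₂ : ∀ y, ‖(Δ U) y‖ ≤ C₂)
    (hm : ContDiff ℝ 2 m) (hmpos : ∀ y, 0 < m y)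
    (hker : ∀ y, (Δ m) y + VectorCalculus.divergence
      (fun z => m z • (U z + (1 / 2 : ℝ) • z - α • rotGen z)) y = 0)
    (hmup : ∀ y, m y ≤ M₁ * Real.exp (-(1 / 16 : ℝ) * ‖y‖ ^ 2))
    (hgradm : ∀ y, ‖fderiv ℝ m y‖ ≤ M₂ * Real.exp (-(1 / 32 : ℝ) * ‖y‖ ^ 2)) :
    2 * ∫ y, (curl U y) 2 * m y = ∫ y, P y * fderiv ℝ m y (rotGen y) := by
  have hPd : Differentiable ℝ P := hP.differentiable (by simp)
  set Cp : ℝ := |α| * (C₀ + C₁) + C₀ + C₁ + C₂ + C₁ * C₀ with hCp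
  have hCp0 : 0 ≤ Cp := by
    have hC₂0 : 0 ≤ C₂ := (norm_nonneg _).trans (hC₂ 0)
    have hC₁0 : 0 ≤ C₁ := (norm_nonneg _).trans (hC₁ 0)
    positivity
  have hDPb : ∀ y, ‖fderiv ℝ P y‖ ≤ Cp * (1 + ‖y‖) := fun y => by
    have h := rotationDefect_norm_gradient_pressure_le hC₀ hUb hC₁ hC₂ heq y
    have e : ‖gradient P y‖ = ‖fderiv ℝ P y‖ := by simp [gradient]
    rwa [e] at h
  have hPb : ∀ y, |P y| ≤ (|P 0| + Cp) * (1 + ‖y‖) ^ 2 := rotationDefect_abs_pressure_le hPd hCp0 hDPb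
  rw [torque_pairing hU hP heq hC₀ hUb hC₁ hC₂ hm hmpos hker hmup hgradm]
  exact torque_ibp hP hPb hDPb hm hmpos hmup hgradm

/-! ### Registered form -/

/-- **Registered helper stub `rotationDefect_torqueIdentity`** (explicit-binder form of
`torque_identity`): for smooth `(U, P)` solving the RSS profile system with the Type-I bounds and
a positive `C²` density `m` in the kernel of the rotating adjoint with Gaussian bounds on `m`,
`Dm`: `2 ∫ (curl U)₂ m = ∫ P Dm(Jy)`. [cite: PineauVicol2026, (5.4) (p. 13), Lemma 4.1 (4.6) (p. 12)] -/
theorem rotationDefect_torqueIdentity :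
    ∀ (α C₀ C₁ C₂ M₁ M₂ : ℝ) (U : EuclideanSpace ℝ (Fin 3) → EuclideanSpace ℝ (Fin 3)) (P m : EuclideanSpace ℝ (Fin 3) → ℝ), ContDiff ℝ (⊤ : ℕ∞) U → ContDiff ℝ (⊤ : ℕ∞) P → (∀ y : EuclideanSpace ℝ (Fin 3), α • (Literature.Analysis.FluidPDE.rotGen (U y) - fderiv ℝ U y (Literature.Analysis.FluidPDE.rotGen y)) + (1 / 2 : ℝ) • U y + (1 / 2 : ℝ) • fderiv ℝ U y y - Laplacian.laplacian U y + fderiv ℝ U y (U y) + gradient P y = 0) → 0 ≤ C₀ → (∀ y : EuclideanSpace ℝ (Fin 3), ‖U y‖ ≤ C₀) → (∀ y : EuclideanSpace ℝ (Fin 3), ‖fderiv ℝ U y‖ ≤ C₁) → (∀ y : EuclideanSpace ℝ (Fin 3), ‖Laplacian.laplacian U y‖ ≤ C₂) → ContDiff ℝ 2 m → (∀ y : EuclideanSpace ℝ (Fin 3), 0 < m y) → (∀ y : EuclideanSpace ℝ (Fin 3), Laplacian.laplacian m y + Literature.Analysis.FluidPDE.VectorCalculus.divergence (fun z => m z • (U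 z + (1 / 2 : ℝ) • z - α • Literature.Analysis.FluidPDE.rotGen z)) y = 0) → (∀ y : EuclideanSpace ℝ (Fin 3), m y ≤ M₁ * Real.exp (-(1 / 16 : ℝ) * ‖y‖ ^ 2)) → (∀ y : EuclideanSpace ℝ (Fin 3), ‖fderiv ℝ m y‖ ≤ M₂ * Real.exp (-(1 / 32 : ℝ) * ‖y‖ ^ 2)) → 2 * ∫ y : EuclideanSpace ℝ (Fin 3), (Literature.Analysis.FluidPDE.curl U y) 2 * m y = ∫ y : EuclideanSpace ℝ (Fin 3), P y * fderiv ℝ m y (Literature.Analysis.FluidPDE.rotGen y) :=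
  fun _ _ _ _ _ _ _ _ _ hU hP heq hC₀ hUb hC₁ hC₂ hm hmpos hker hmup hgradm =>
    torque_identity hU hP heq hC₀ hUb hC₁ hC₂ hm hmpos hker hmup hgradm

end Summit.NavierStokesRegularity.NavierStokesRegularity.Theorems

end
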